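import Summits.QuantumFields.BalabanUV.Beta.FP.TowerQN2RowJet
import Summits.QuantumFields.BalabanUV.Beta.FP.TorusCompositeVertexJunctionTwoSym

/-!
# `BalabanUV.Beta.FP.TowerQN2RowJunction` — road «FP», binder row D1, ROUTE T (β1), (E4e²) PART 2: **THE ROAD's SIDE OF THE SECOND-ORDER 𝔔-JUNCTION** — the END
# wrapper's symmetrised conjugated second jet along two pinned directions, ENTRYWISE on the (multiplier, field) slots, IS `c²·r²·Σ_full` times the DOUBLE column
# sum of the torus ℋ-columns of the two sources against F5-Sym's ALL-PAIRS-OF-COPIES periodisation of leaf-02's packed sym second-order family: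
# `(½•(𝔔′₂f (r•e_a) (r•e_{a′}) + sym)) (x̄,κ₀) (z,β) = (c²·r·r·Σ_full) · Σ_b Σ_{b′} colN̂_a b · colN̂_{a′} b′ · Σ'_{m₁ m₂ m} packVH (K₂ˢ … (b.2, b.1 + T m₁) ·) (Lc^(n+2)) b′.2 (b′.1 + T m₂) (Lc^(n+2)•x̄) (z + T m) (inr κ₀) (inl β)`

WHY (`HOME/b2b-balaban-beta-d1-p3/g42/SPEC-54.md` §3, `g43/SPEC-55.md` §4).  #6 `TowerQN2RowJet.Qprime2_symm_eq_smul_compIns22Sym_cols` gave the matrix form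
`(c²·r·r) • compIns₂₂Sym … (n+2) colN̂_a colN̂_{a′}`; leaf-02 g32's F5-Sym `TorusCompositeVertexJunctionTwoSym.sum_sum_mul_tsum₂_compVh2S_eq_compIns₂₂Sym_apply` writes
every (multiplier, field) entry of `compIns₂₂Sym … h h′` as the double weight sum against the triple copy sum of the packed family `u_{n+2} • packVH (compVH2Ker ℓˢ 𝓋ˢ 𝓋₂ˢ
Lc (n+2) …)` — the torus bi-member of J-NOTE-7 §4 (`G_T(b,b′)(X,z) = Σ_{m₁ m₂ m} 𝒦(b+Tm₁, b′+Tm₂)(X, z+Tm)`).  This file is the order-2 twin of #4 `TowerQN1Row` §3's first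
step (`compIns1Sym_apply_eq_sigmaFull_mul_sum`): the unit `u_{n+2}` is `Σ_full = Π_{ℓ<n+2} stepScale 3 Lc ℓ·#B` (#3 `unit_eq_sigmaFull`) and comes OUT of the triple
`Σ'` and the double `Σ` — so the v5 row `hQN₂`'s LEFT side is in PRODUCT FORM `Σ_b Σ_{b′} colN̂ colN̂ · (…)`, the shape an2's WOUND folds (PART 14b
`NVertexWoundFoldAssembly.perF_dper_tsum_vertex2OfK_translate` and its sector sequels) give for the RIGHT side `perF T (dper T (Σ' e, WN♮ μ y ν (y′ + Mc∘e)))`.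
WHAT ([folklore] `Finset`∕`tsum`∕`ring` bookkeeping BY NAME; no `def`, no `def … : Prop`, nothing cited, 0 sorry):
§1 **`compIns22Sym_apply_eq_sigmaFull_mul_sum_sum`** (F5-Sym at two bond weights, `Σ_full` out); §2 **`Qprime2_symm_apply_eq_sigmaFull_mul_sum_sum`** (#6 §3 entrywise
composed with §1: the displayed formula above, scalar `c²·r·r·Σ_full`).
NOT HERE (sequel `TowerQN2Row`, on an2's sector folds + the (C1) table word at order 2): the identification, termwise in `(b, b′)`, of the packed sym family's triple copy sum
with the sectors of `perF T (dper T (wound WN♮))` (vertex2 ∕ mixed ∕ response), the slot bridge to `fN (x̄, κ₀)`, and the second-order LOCK ROWS on `Pn.cE₂ ∕ Pn.cB ∕ Pn.T (n+2)`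
(SPEC-54 §5) that turn `c²·r·r·Σ_full` into the pins' numerals; nothing of Bałaban's asserted, valued or discharged; 0 estimates; 0∕4 row-D1 binders (hW, hR, D1Tel, D1Rep);
ROOT M‴ p325680 ∕ P5c ∕ D6 untouched; NOT (C1), NOT `hQN₂`, NOT (T-ID), NOT D1, NEVER «G-an2-4 closed», NOT BetaPertH, NOT continuum, NOT Clay.

HONEST DEPENDENCY (page 1, mandatory): continuum YM on T⁴ ⇐ BetaPertH ∧ nine spine estimates (0/9 proved); BetaPertH ⇐ (D1) ∧ (D4) ∧ CAP+tail;
G-an2-4 gates asym, D1 and NE2/3/4.  HONEST FRAMING (cell contract, verbatim): «discharging `BetaPertH` makes Bałaban's UV stability UNCONDITIONAL —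
a real constructive-QFT result; it is NOT the continuum limit and NOT the Clay problem.»  ABSOLUTE RULE (cell charter, verbatim): «No internally-minted
statement may enter as a cited fact. Every hypothesis is either kernel-proved in this package or a verbatim quotation of a PUBLISHED theorem with page
reference. The manuscript(s) under audit are NOT citable for their own disputed steps — they are the thing under adjudication; programme-internal
(2001/route/tribunal) claims are never citable.»  Road «FP» OWNER, b2b-balaban-beta-d1-p3 gen 43, 2026-08-27.  No existing file touched.
-/

noncomputable section

open scoped BigOperators

namespace Summit.QuantumFields.BalabanUV.Beta.FP.TowerQN2RowJunction

open Finset Matrix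
open Literature.MathematicalPhysics.QuantumFieldTheory
open Literature.MathematicalPhysics.QuantumFieldTheory.Balaban1983to89
open Literature.MathematicalPhysics.QuantumFieldTheory.Balaban1983to89.Beta
open B4TorusKernel.MultiPeriod (translate)
open B5Prop11Plancherel (fine)
open B6Lemma24Torus (pbox)
open AffineAveraging (Site box toSite)
open AveragingContoursRooted (ctr ctrOff)
open AveragingHessianKernels (packVH)
open ExpKernelCalculus (MKer)
open OneStepResolventKernel (Fib)
open Summit.QuantumFields.BalabanUV.Beta.BorderedHessian (stepScale)
open Summit.QuantumFields.BalabanUV.Beta.SymAveragingHessianCounts (symLinKerAt symVhKerAt)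
open Summit.QuantumFields.BalabanUV.Beta.SymAveragingMixedJetTables (symVh2KerAt)
open Summit.QuantumFields.BalabanUV.Beta.CompositeVertexKernelRec (compVH2Ker)
open Summit.QuantumFields.BalabanUV.Beta.CompositeOneShotJetData (Roots AN)
open Summit.QuantumFields.BalabanUV.Beta.FP.KernelPeriodisationFib (Idx perF)
open Summit.QuantumFields.BalabanUV.Beta.FP.TorusGaugeCovariance (tgrad)
open Summit.QuantumFields.BalabanUV.Beta.FP.TorusGaugeCovariancePairing (wrapPt)
open Summit.QuantumFields.BalabanUV.Beta.FP.TorusCompositeObjects (towerTorus)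
open Summit.QuantumFields.BalabanUV.Beta.FP.TorusCompositeCovariance (itRoot)
open Summit.QuantumFields.BalabanUV.Beta.FP.TorusCompositeObjectsG (compRowsSym)
open Summit.QuantumFields.BalabanUV.Beta.FP.TorusCompositeCovarianceOneSym (compIns₁Sym)
open Summit.QuantumFields.BalabanUV.Beta.FP.TorusCompositeCovarianceTwoPolarSym (compIns₂₂Sym)
open Summit.QuantumFields.BalabanUV.Beta.FP.TowerQN1RowJet (unit_eq_sigmaFull)
open Summit.QuantumFields.BalabanUV.Beta.FP.TowerQN2RowJet (Qprime2_symm_eq_smul_compIns22Sym_cols)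
open Summit.QuantumFields.BalabanUV.Beta.FP.TorusCompositeVertexJunctionTwoSym (sum_sum_mul_tsum₂_compVh2S_eq_compIns₂₂Sym_apply)

variable {Lc : ℕ} [NeZero Lc] (M : Fin (3 + 1) → ℕ) [∀ μ, NeZero (M μ)] (n : ℕ) (c : ℝ)

/-! ## §1 F5-Sym at two bond weights, `Σ_full` out -/

section Fold

variable (hc : ctrOff (3 + 1) Lc ∈ box (3 + 1) Lc)

include hc in
/-- [folklore] **`compIns22Sym_apply_eq_sigmaFull_mul_sum_sum` — F5-Sym AT TWO BOND WEIGHTS, `Σ_full` OUT**: every (multiplier, field) entry of leaf-02's sym composite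
second-order bi-jet `compIns₂₂Sym … (n+2) h h′` is `Σ_full · Σ_b Σ_{b′} h b · h′ b′ · Σ'_{m₁ m₂ m} packVH (K₂ˢ … (b.2, b.1 + T m₁) ·) (Lc^(n+2)) b′.2 (b′.1 + T m₂) (Lc^(n+2)•x̄) (z + T m)
(inr κ₀) (inl β)` (F5-Sym `sum_sum_mul_tsum₂_compVh2S_eq_compIns₂₂Sym_apply` VERBATIM at `lev := fun i => n+1−(i−1)`; `unit_eq_sigmaFull`; `Pi.smul_apply`, `tsum_mul_left`). -/
theorem compIns22Sym_apply_eq_sigmaFull_mul_sum_sum (h h' : ↥(pbox (towerTorus Lc (fine Lc M) (n + 1))) × Fin (3 + 1) → ℝ)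
    (x : ↥(pbox M)) (κ₀ : Fin (3 + 1)) (z : ↥(pbox (towerTorus Lc (fine Lc M) (n + 1)))) (β : Fin (3 + 1)) :
    compIns₂₂Sym Lc M (fun i : ℕ => n + 1 - (i - 1)) (fun _ : ℕ => ctrOff (3 + 1) Lc) (n + 1 + 1) h h' (x, κ₀) (z, β)
      = (∏ ℓ ∈ range (n + 1 + 1), (stepScale 3 Lc ℓ * ((box (3 + 1) Lc).card : ℝ))) *
          ∑ b : ↥(pbox (towerTorus Lc (fine Lc M) (n + 1))) × Fin (3 + 1), ∑ b' : ↥(pbox (towerTorus Lc (fine Lc M) (n + 1))) × Fin (3 + 1), h b * (h' b' *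
            ∑' m₁ : Site (3 + 1), ∑' m₂ : Site (3 + 1), ∑' m : Site (3 + 1),
              packVH (fun μ y f f' => compVH2Ker (fun _ : ℕ => symLinKerAt (ctr (3 + 1) Lc) Lc) (fun _ : ℕ => symVhKerAt (ctr (3 + 1) Lc) Lc)
                (fun (_ : ℕ) μ y g g₁ g₂ => (1 / 2 : ℝ) * (symVh2KerAt (ctr (3 + 1) Lc) Lc μ y g g₁ g₂ + symVh2KerAt (ctr (3 + 1) Lc) Lc μ y g g₂ g₁)) Lc (n + 1 + 1) μ y f
                  (b.2, translate (towerTorus Lc (fine Lc M) (n + 1)) (b.1 : Site (3 + 1)) m₁) f') (Lc ^ (n + 1 + 1)) b'.2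
                  (translate (towerTorus Lc (fine Lc M) (n + 1)) (b'.1 : Site (3 + 1)) m₂)
                ((((Lc ^ (n + 1 + 1) : ℕ) : ℤ)) • (x : Site (3 + 1))) (translate (towerTorus Lc (fine Lc M) (n + 1)) (z : Site (3 + 1)) m) (Sum.inr κ₀) (Sum.inl β)) := by
  -- F5-Sym VERBATIM, READ at the wrapper's spelling of the finest torus (`towerTorus Lc M (n+2)` is `towerTorus Lc (fine Lc M) (n+1)` definitionally)
  have key : compIns₂₂Sym Lc M (fun i : ℕ => n + 1 - (i - 1)) (fun _ : ℕ => ctrOff (3 + 1) Lc) (n + 1 + 1) h h' (x, κ₀) (z, β)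
      = ∑ b : ↥(pbox (towerTorus Lc (fine Lc M) (n + 1))) × Fin (3 + 1), ∑ b' : ↥(pbox (towerTorus Lc (fine Lc M) (n + 1))) × Fin (3 + 1), h b * (h' b' *
          ∑' m₁ : Site (3 + 1), ∑' m₂ : Site (3 + 1), ∑' m : Site (3 + 1),
            (((∏ i ∈ range (n + 1 + 1), stepScale 3 Lc ((fun i : ℕ => n + 1 - (i - 1)) (i + 1))) * ((box (3 + 1) Lc).card : ℝ) ^ (n + 1 + 1)) •
              packVH (fun μ y f f' => compVH2Ker (fun _ : ℕ => symLinKerAt (ctr (3 + 1) Lc) Lc) (fun _ : ℕ => symVhKerAt (ctr (3 + 1) Lc) Lc)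
                (fun (_ : ℕ) μ y g g₁ g₂ => (1 / 2 : ℝ) * (symVh2KerAt (ctr (3 + 1) Lc) Lc μ y g g₁ g₂ + symVh2KerAt (ctr (3 + 1) Lc) Lc μ y g g₂ g₁)) Lc (n + 1 + 1) μ y f
                  (b.2, translate (towerTorus Lc (fine Lc M) (n + 1)) (b.1 : Site (3 + 1)) m₁) f') (Lc ^ (n + 1 + 1)) b'.2
                  (translate (towerTorus Lc (fine Lc M) (n + 1)) (b'.1 : Site (3 + 1)) m₂))
              ((((Lc ^ (n + 1 + 1) : ℕ) : ℤ)) • (x : Site (3 + 1))) (translate (towerTorus Lc (fine Lc M) (n + 1)) (z : Site (3 + 1)) m) (Sum.inr κ₀) (Sum.inl β)) :=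
    (sum_sum_mul_tsum₂_compVh2S_eq_compIns₂₂Sym_apply Lc hc (n + 1 + 1) M (fun i : ℕ => n + 1 - (i - 1)) (fun _ : ℕ => ctrOff (3 + 1) Lc) h h' x κ₀ z β).symm
  rw [key, unit_eq_sigmaFull, Finset.mul_sum]
  refine Finset.sum_congr rfl fun b _ => ?_
  rw [Finset.mul_sum]
  refine Finset.sum_congr rfl fun b' _ => ?_
  simp only [Pi.smul_apply, smul_eq_mul, tsum_mul_left]
  ring

end Fold

/-! ## §2 The END wrapper's symmetrised conjugated second jet, entrywise, in product form -/

section Row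

variable (hc : ctrOff (3 + 1) Lc ∈ box (3 + 1) Lc)
  {κ : Type*} [Fintype κ] [DecidableEq κ] (yN : κ → Site (3 + 1)) (μN : κ → Fin (3 + 1))
  -- the nested column and its tree-gauge read-out (v5's `hv ∕ hhvl ∕ lv ∕ hlv`) and the (J-W″) letter at `r := 1` (as #3∕#6)
  (hv : (κ → ℝ) → (↥(pbox (towerTorus Lc (fine Lc M) (n + 1))) × Fin (3 + 1) → ℝ))
  (hhvl : ∀ (r : ℝ) (x y : κ → ℝ), hv (r • x + y) = r • hv x + hv y)
  (lv : (κ → ℝ) → ↥(pbox (towerTorus Lc (fine Lc M) (n + 1))) → ℝ)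
  (hlv : ∀ (r : ℝ) (x y : κ → ℝ), lv (r • x + y) = r • lv x + lv y)
  (hJW : ∀ (a : κ) (b : ↥(pbox (towerTorus Lc (fine Lc M) (n + 1))) × Fin (3 + 1)), hv (Pi.single a 1) b
      = perF (towerTorus Lc (fine Lc M) (n + 1)) (AN (Roots.ctr Lc) (n + 1)) (b.1, Sum.inl b.2)
          (wrapPt (towerTorus Lc (fine Lc M) (n + 1)) (((Lc ^ (n + 1 + 1) : ℕ) : ℤ) • yN a), Sum.inr (μN a))
        - ∑ s : ↥(pbox (towerTorus Lc (fine Lc M) (n + 1))), tgrad (towerTorus Lc (fine Lc M) (n + 1)) (b.1, Sum.inl b.2) s * lv (Pi.single a 1) s)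
  -- #6's letters: the composite rows `𝔔₀` NAMED as `compRowsSym … (n+2)`, `𝔔₁f = c • compIns₁Sym`, the symmetrised `𝔔₂f = c² • compIns₂₂Sym`, `Xbf` instantiated, `h𝔔′₂f` as a value
  (𝔔₀ : Matrix ((↥(pbox M) × Fin (3 + 1))) (↥(pbox (towerTorus Lc (fine Lc M) (n + 1))) × Fin (3 + 1)) ℝ)
  (h𝔔₀' : 𝔔₀ = (compRowsSym Lc M (fun i : ℕ => n + 1 - (i - 1)) (fun _ : ℕ => ctrOff (3 + 1) Lc) (n + 1 + 1) :
      Matrix ((↥(pbox M) × Fin (3 + 1))) (↥(pbox (towerTorus Lc (fine Lc M) (n + 1))) × Fin (3 + 1)) ℝ))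
  (𝔔₁f : (κ → ℝ) → Matrix ((↥(pbox M) × Fin (3 + 1))) (↥(pbox (towerTorus Lc (fine Lc M) (n + 1))) × Fin (3 + 1)) ℝ)
  (h𝔔₁' : ∀ v, 𝔔₁f v = c • compIns₁Sym Lc M (fun i : ℕ => n + 1 - (i - 1)) (fun _ : ℕ => ctrOff (3 + 1) Lc) (n + 1 + 1) (hv v))
  (𝔔₂f : (κ → ℝ) → (κ → ℝ) → Matrix ((↥(pbox M) × Fin (3 + 1))) (↥(pbox (towerTorus Lc (fine Lc M) (n + 1))) × Fin (3 + 1)) ℝ)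
  (h𝔔₂' : ∀ v v', (1 / 2 : ℝ) • (𝔔₂f v v' + 𝔔₂f v' v)
    = c ^ 2 • compIns₂₂Sym Lc M (fun i : ℕ => n + 1 - (i - 1)) (fun _ : ℕ => ctrOff (3 + 1) Lc) (n + 1 + 1) (hv v) (hv v'))
  (Xbf : (κ → ℝ) → Matrix ((↥(pbox M) × Fin (3 + 1))) ((↥(pbox M) × Fin (3 + 1))) ℝ)
  (hXbf : ∀ v, Xbf v = c • Matrix.diagonal (fun a : (↥(pbox M) × Fin (3 + 1)) =>
    lv v (itRoot Lc M (fun _ : ℕ => ctrOff (3 + 1) Lc) (fun _ => hc) (n + 1 + 1) a.1)))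
  (𝔔'₂f : (κ → ℝ) → (κ → ℝ) → Matrix ((↥(pbox M) × Fin (3 + 1))) (↥(pbox (towerTorus Lc (fine Lc M) (n + 1))) × Fin (3 + 1)) ℝ)
  (h𝔔'₂f : ∀ v v', 𝔔'₂f v v' = Xbf v * Xbf v' * 𝔔₀ + (Xbf v * 𝔔₁f v' + Xbf v * 𝔔₀ * (-(c • Matrix.diagonal (fun b : (↥(pbox (towerTorus Lc (fine Lc M) (n + 1))) × Fin (3 + 1)) => lv v' b.1))))
      + ((Xbf v * 𝔔₁f v' + Xbf v * 𝔔₀ * (-(c • Matrix.diagonal (fun b : (↥(pbox (towerTorus Lc (fine Lc M) (n + 1))) × Fin (3 + 1)) => lv v' b.1)))) + (𝔔₂f v v' + 𝔔₁f v * (-(c • Matrix.diagonal (fun b : (↥(pbox (towerTorus Lc (fine Lc M) (n + 1))) × Fin (3 + 1)) => lv v' b.1))) + (𝔔₁f v * (-(c • Matrix.diagonal (fun b : (↥(pbox (towerTorus Lc (fine Lc M) (n + 1))) × Fin (3 + 1)) => lv v' b.1))) + 𝔔₀ * ((-(c • Matrix.diagonal (fun b : (↥(pbox (towerTorus Lc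 (fine Lc M) (n + 1))) × Fin (3 + 1)) => lv v b.1))) * (-(c • Matrix.diagonal (fun b : (↥(pbox (towerTorus Lc (fine Lc M) (n + 1))) × Fin (3 + 1)) => lv v' b.1))))))))
  (r : ℝ) (a a' : κ)

omit [Fintype κ] in
include hhvl hlv hJW h𝔔₀' h𝔔₁' h𝔔₂' hXbf h𝔔'₂f in
/-- [folklore] **`Qprime2_symm_apply_eq_sigmaFull_mul_sum_sum` — THE v5 ROW `hQN₂`'s LEFT SIDE, ENTRYWISE, IN PRODUCT FORM**: for #6's letters,
`(½•(𝔔′₂f (r•e_a) (r•e_{a′}) + 𝔔′₂f (r•e_{a′}) (r•e_a))) (x̄,κ₀) (z,β) = (c²·r·r·Σ_full) · Σ_b Σ_{b′} colN̂_a b · colN̂_{a′} b′ · Σ'_{m₁ m₂ m} packVH (K₂ˢ …) …` (#6 §3 + §1). -/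
theorem Qprime2_symm_apply_eq_sigmaFull_mul_sum_sum
    (x : ↥(pbox M)) (κ₀ : Fin (3 + 1)) (z : ↥(pbox (towerTorus Lc (fine Lc M) (n + 1)))) (β : Fin (3 + 1)) :
    ((1 / 2 : ℝ) • (𝔔'₂f (r • (Pi.single a (1 : ℝ) : κ → ℝ)) (r • (Pi.single a' (1 : ℝ) : κ → ℝ))
        + 𝔔'₂f (r • (Pi.single a' (1 : ℝ) : κ → ℝ)) (r • (Pi.single a (1 : ℝ) : κ → ℝ)))) (x, κ₀) (z, β)
      = (c ^ 2 * r * r * ∏ ℓ ∈ range (n + 1 + 1), (stepScale 3 Lc ℓ * ((box (3 + 1) Lc).card : ℝ))) *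
          ∑ b : ↥(pbox (towerTorus Lc (fine Lc M) (n + 1))) × Fin (3 + 1), ∑ b' : ↥(pbox (towerTorus Lc (fine Lc M) (n + 1))) × Fin (3 + 1),
            perF (towerTorus Lc (fine Lc M) (n + 1)) (AN (Roots.ctr Lc) (n + 1)) (b.1, Sum.inl b.2)
                (wrapPt (towerTorus Lc (fine Lc M) (n + 1)) (((Lc ^ (n + 1 + 1) : ℕ) : ℤ) • yN a), Sum.inr (μN a)) *
              (perF (towerTorus Lc (fine Lc M) (n + 1)) (AN (Roots.ctr Lc) (n + 1)) (b'.1, Sum.inl b'.2)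
                  (wrapPt (towerTorus Lc (fine Lc M) (n + 1)) (((Lc ^ (n + 1 + 1) : ℕ) : ℤ) • yN a'), Sum.inr (μN a')) *
                ∑' m₁ : Site (3 + 1), ∑' m₂ : Site (3 + 1), ∑' m : Site (3 + 1),
                  packVH (fun μ y f f' => compVH2Ker (fun _ : ℕ => symLinKerAt (ctr (3 + 1) Lc) Lc) (fun _ : ℕ => symVhKerAt (ctr (3 + 1) Lc) Lc)
                    (fun (_ : ℕ) μ y g g₁ g₂ => (1 / 2 : ℝ) * (symVh2KerAt (ctr (3 + 1) Lc) Lc μ y g g₁ g₂ + symVh2KerAt (ctr (3 + 1) Lc) Lc μ y g g₂ g₁)) Lc (n + 1 + 1) μ y f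
                      (b.2, translate (towerTorus Lc (fine Lc M) (n + 1)) (b.1 : Site (3 + 1)) m₁) f') (Lc ^ (n + 1 + 1)) b'.2
                      (translate (towerTorus Lc (fine Lc M) (n + 1)) (b'.1 : Site (3 + 1)) m₂)
                    ((((Lc ^ (n + 1 + 1) : ℕ) : ℤ)) • (x : Site (3 + 1))) (translate (towerTorus Lc (fine Lc M) (n + 1)) (z : Site (3 + 1)) m)
                    (Sum.inr κ₀) (Sum.inl β)) := by
  rw [Qprime2_symm_eq_smul_compIns22Sym_cols M n c hc yN μN hv hhvl lv hlv hJW 𝔔₀ h𝔔₀' 𝔔₁f h𝔔₁' 𝔔₂f h𝔔₂' Xbf hXbf 𝔔'₂f h𝔔'₂f r a a',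
    Matrix.smul_apply, smul_eq_mul]
  exact (congrArg (HMul.hMul (c ^ 2 * r * r)) (compIns22Sym_apply_eq_sigmaFull_mul_sum_sum M n hc _ _ x κ₀ z β)).trans (mul_assoc _ _ _).symm

end Row

end Summit.QuantumFields.BalabanUV.Beta.FP.TowerQN2RowJunction

end
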